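import Mathlib.LinearAlgebra.Matrix.Kronecker
import Mathlib.Analysis.SpecialFunctions.Pow.Real
import Literature.Computability.AlgebraicComplexity.LandsbergRessayre
import Literature.Computability.AlgebraicComplexity.LandsbergRessayreNormalForm
import Literature.Computability.AlgebraicComplexity.GrenetEquivariant
import Literature.Computability.AlgebraicComplexity.MatMulRankLowerBoundsProofs
import HarnessLib

/-!
# Landsberg–Ressayre 2017, §2.1–§2.5: equivariant and regular determinantal representations
# (Props. 2.10, 2.11, Def. 2.12 (`rdc`, regular `edc`), Thms. 2.13, 2.14, Props. 2.16, 2.17; Questions 2.2,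
# 2.7, 2.18 and Cor. 2.3 recorded) — typed as printed

Topic `Literature/Computability/AlgebraicComplexity` (cell val-lit, typer t12, DAG row LR17-A).
Source: J. M. Landsberg, N. Ressayre, *Permanent v. determinant: an exponential lower bound
assuming symmetry and a potential path towards Valiant's conjecture*, Differential Geom. Appl.
**55** (2017) 146–166 = arXiv:1508.05788 [LandsbergRessayre2017]; held text `paper:arxiv-1508.05788`
(locators `pNNNN:Lnn` below are lines of its page files).

## What the tree already has (CITED, not restated)

* Defs. 1.2–1.3, 1.5 (`Ã` respects `G`; `edc`): `IsEquivariantDetRepr Γ f A`, `HasEquivariantDetRepr`,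
  `equivariantDetComplexity` (`EquivariantDC.lean`) — EXACT lifts `A(γ·x) = g·A(x)·h⁻¹`,
  `(g, h) ∈ GL_n × GL_n`, i.e. LR's `𝔾_{det_n}` WITHOUT its transposition component `ℤ₂`
  (`EquivariantDC.lean`, "Design choices"). Consequences used throughout this file: every LR LOWER
  bound transfers verbatim to the tree's notion; an UPPER bound (a construction) transfers when the
  printed proof exhibits exact lifts in `GL_n × GL_n` — which is the case for Props. 2.10, 2.16, 2.17
  (p0012:L52–L63 and p0013:L101–L109: `GL(E) × GL(F)` acts through the functorial maps `∧^j`, and the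
  transposition of `M_m(ℂ)` is realised by two PERMUTATION matrices `B₁, B₂`, `Ã(Mᵀ) = B₁ Ã(M) B₂⁻¹`)
  and for Example 1.4 (p0004:L6–L62). It is NOT the case for the remark "the trivial representation
  of `det_m` is equivariant, so `edc(det_m) = m`" (p0006:L124–L125), which uses `transp ∈ 𝔾_{det_n}`;
  that remark is therefore not typed.
* §2.1 `𝔾_{perm_m}` realised in `GL(m²)`: `monomialSubgroup`, `leftMonomialSubst`, `rightMonomialSubst`,
  `transposeSubstSet`, `permSymmetrySubst` (`LandsbergRessayre.lean`).
* Thm. 2.1 `≥` and Thm. 2.8 `≥`: named facts `lr_full_equivariant_lower`, `lr_left_equivariant_lower`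
  (`LandsbergRessayre.lean`), BOTH DISCHARGED (`lr_full_equivariant_lower_holds`,
  `LandsbergRessayreThm21Proofs.lean`; `lr_left_equivariant_lower_holds`, `LandsbergRessayreProofs.lean`).
* Prop. 2.9 / Thm. 2.8 "Moreover" (Grenet's representation respects `N(T^{GL(E)})`, size `2^m - 1`):
  `Grenet.repr`, `Grenet.isAffineDetRepr_repr`, `Grenet.isEquivariantDetRepr_repr` (two-sided torus,
  `GrenetEquivariant.lean`) and, summit-side, `…ProjectionStabilityOptStep.GrenetLeftEquivariant.
  isEquivariantDetRepr_leftMonomialSubst_repr` (full `N(T^{GL(E)})`).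
* Def. 2.12 (regular): `IsRegularDetRepr`, `constPart` (`LandsbergRessayreNormalForm.lean`); Lemma 3.2
  (von zur Gathen): `vonzurGathen1987_perm_detRepr_rank(_holds)`, `isRegularDetRepr_perPoly`; §3.3
  normal form: `IsRegularDetRepr.exists_normalForm`.
* "characterized by its symmetries" (p0003:L62–L67): `IsCharacterizedByStabilizer` (+ `_holds` for
  `per`, `det`; `CharacterizedByStabilizer.lean`); Conjecture 1.1 (Valiant) in `dc` form:
  `DcPerSuperpolynomial ℂ` (`PermanentVsDeterminant.lean`, an OPEN statement, used only as a conclusion).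
* `𝔾_{det_m} = [(GL(E) × GL(F))/ℂ*] ⋊ ℤ₂` (p0003:L56–L58, [Frobenius 1897]): in tree as
  `Literature.NumberTheory.DiophantineGeometry.frobenius_detPreserver_unimodular_sandwich(_holds)`.

## What this file adds

Definitions (with bodies): `projLinStabilizer f` (LR's projective symmetry group `𝔾_P`, p0003:L49);
`leftLinearSubst`, `rightLinearSubst`, `detSymmetrySubst` (the realised `GL(E)`, `GL(F)` and
`𝔾_{det_m}` acting on `M_m = Hom(F, E)`, p0005:L108–L112, p0003:L56–L59); `HasRegularDetRepr`,
`regularDetComplexity` (= `rdc`), `HasRegularEquivariantDetRepr`, `regularEquivariantDetComplexity`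
(= LR's `edc` restricted to regular representations, printed `\srdc`; p0006:L118–L120);
`IsNondegQuadraticForm` (p0006:L100); the explicit matrices of Example 1.4 (`LR17.quadricMatrix`),
Prop. 2.10 (`LR17.permFullMatrix`), Prop. 2.16 (`LR17.detHalfMatrix`), Prop. 2.17 (`LR17.detFullMatrix`)
on their natural index types `LR17.HalfIdx m = {S ⊊ [m]}` (`⊕_{j<m} Λ^j E`, resp. `(S^jE)_reg`) and
`LR17.FullIdx m = {(S, R) : |S| = |R| < m}` (`⊕_{j<m} Λ^jE ⊗ Λ^jF*`), with the printed scalar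
`LR17.lamScale m = (m!)^{-1/(n-m)}`.

Named facts (D-0014; not proved here): `lr_prop_2_10`, `lr_prop_2_11_le`, `lr_prop_2_11_ge` (with an
ERRATUM, see its docstring), `lr_thm_2_13_ge`, `lr_thm_2_14_ge`, `lr_prop_2_16`, `lr_prop_2_17`, and,
answering Question 2.18, `ikenmeyerLandsberg2017_prop_2_3` [IkenmeyerLandsberg2017, Prop. 2.3].

The paper's OPEN QUESTIONS are not Literature declarations (no `def` here; conjectures / open questions
live summit-side): **Question 2.2** (p0005:L16–L17) "Does there exist a polynomial `e(d)` such that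
`edc(perm_m) ≤ e(dc(perm_m))`?" (route-side, in quasi-polynomial / left-symmetry form, this is crux
`DetqpSymmetrization`, stmt-ValiantsHypothesis-0319); **Question 2.7** (p0005:L87–L91) "Does every `P` that
is determined by its symmetry group admit a determinantal representation that respects its symmetries?
… how much larger must such a representation be?"; **Question 2.18** (p0007:L104–L109) "What is the
growth of `rdc(det_m)`?" — ANSWERED in print: polynomial, `rdc(det_m) ≤ (m³ - m)/3 + 1`
(Ikenmeyer–Landsberg 2017, Prop. 2.3, the named fact `ikenmeyerLandsberg2017_prop_2_3` below).
**Cor. 2.3** (p0005:L21–L22: an affirmative answer to Question 2.2 implies Conjecture 1.1) is a theorem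
whose hypothesis is Question 2.2 spelled out; it is proved from `lr_full_equivariant_lower_holds` in the
companion `LR17EquivariantRepresentationsProofs.lean` (`lr_cor_2_3`, conclusion `DcPerSuperpolynomial ℂ`).

Proved here: small API, and `lr_prop_2_11_eq` (Prop. 2.11 from its two halves). The remaining printed
consequences (Cor. 2.3; Thm. 2.1 / 2.13 / 2.14 as equalities from the facts above; the cardinalities
`|HalfIdx m| = 2^m - 1`, `|FullIdx m| = C(2m,m) - 1`) are proved in the companion
`LR17EquivariantRepresentationsProofs.lean`.

Honest framing: typed literature; `VP ≠ VNP` / Conjecture 1.1 is NOT proved and nothing here is progress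
on it. The numerical sanity check of the four explicit matrices (determinants for `m ≤ 5` against the
printed signs and scalars) is recorded in the typer's notes, not shipped.
-/

noncomputable section

open MvPolynomial Matrix
open scoped Kronecker

namespace Literature.Computability.AlgebraicComplexity

universe u v

/-! ## §1 (p0003:L47–L55): the projective symmetry group `𝔾_P` -/

section ProjStabilizer

variable {k : Type u} [CommRing k] {σ : Type v} [Fintype σ] [DecidableEq σ]

/-- LR's **projective symmetry group** `𝔾_P = {g ∈ GL(V) | P(g⁻¹y) ∈ ℂ* P(y)}` of a polynomial
(p0003:L49), in the tree's conventions (`linSubstRep`, as for `linStabilizer = G_P` in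
`EquivariantDC.lean`): the substitutions `γ` with `γ · f = c • f` for some unit `c` (the value of the
character `χ_P(γ)`, p0003:L53–L55). As a SET it does not depend on the `g` versus `g⁻¹` convention.
[cite: LandsbergRessayre2017, §1 (𝔾_P)] -/
def projLinStabilizer (f : MvPolynomial σ k) : Subgroup (GL σ k) where
  carrier := {γ | ∃ c : kˣ, linSubstRep σ k γ f = (c : k) • f}
  one_mem' := ⟨1, by simp⟩
  mul_mem' := by
    rintro a b ⟨c, hc⟩ ⟨d, hd⟩
    refine ⟨d * c, ?_⟩
    rw [map_mul, Module.End.mul_apply, hd, map_smul, hc, smul_smul, Units.val_mul]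
  inv_mem' := by
    rintro a ⟨c, hc⟩
    refine ⟨c⁻¹, ?_⟩
    have h : linSubstRep σ k a⁻¹ (linSubstRep σ k a f) = f := by
      rw [← Module.End.mul_apply, ← map_mul, inv_mul_cancel, map_one, Module.End.one_apply]
    rw [hc, map_smul] at h
    have h2 := congrArg (fun p => ((c⁻¹ : kˣ) : k) • p) h
    simp only [smul_smul, Units.inv_mul, one_smul] at h2
    exact h2

/-- Membership in `𝔾_P`. [cite: LandsbergRessayre2017, §1 (𝔾_P)] -/
theorem mem_projLinStabilizer {f : MvPolynomial σ k} {γ : GL σ k} :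
    γ ∈ projLinStabilizer f ↔ ∃ c : kˣ, linSubstRep σ k γ f = (c : k) • f := Iff.rfl

/-- `G_P ≤ 𝔾_P` (p0003:L48–L49). [cite: LandsbergRessayre2017, §1 (𝔾_P)] -/
theorem linStabilizer_le_projLinStabilizer (f : MvPolynomial σ k) :
    linStabilizer f ≤ projLinStabilizer f :=
  fun γ hγ => ⟨1, by rw [mem_linStabilizer.mp hγ, Units.val_one, one_smul]⟩

end ProjStabilizer

/-! ## §2.2 / §1 (p0005:L108–L112, p0003:L56–L59): `GL(E)`, `GL(F)` and `𝔾_{det_m}` acting on `M_m` -/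

section MatrixSymmetries

variable (k : Type*) [Field k] (m : ℕ)

/-- **Left multiplication by `GL(E)`** on `M_m(k) = Hom(F, E)` (`(A, B)·x = A x B⁻¹` with `B = 1`,
p0005:L111–L112), as linear substitutions of the `m²` variables: the subgroup generated by the Kronecker
products `g ⊗ 1`, `g ∈ GL_m` (same style as `leftMonomialSubst`, which is the case `g` monomial). This is
the group "`GL(E)`" of Thm. 2.14 and Prop. 2.16 (p0006:L138, p0007:L24). [cite: LandsbergRessayre2017, §2.2] -/
def leftLinearSubst : Subgroup (GL (Fin m × Fin m) k) :=
  Subgroup.closure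
    {γ | ∃ g : GL (Fin m) k,
      (γ : Matrix (Fin m × Fin m) (Fin m × Fin m) k) = (g : Matrix (Fin m) (Fin m) k) ⊗ₖ (1 : Matrix (Fin m) (Fin m) k)}

/-- **Right multiplication by `GL(F)`** on `M_m(k) = Hom(F, E)`: the Kronecker products `1 ⊗ h`,
`h ∈ GL_m` (p0005:L111–L112). [cite: LandsbergRessayre2017, §2.2] -/
def rightLinearSubst : Subgroup (GL (Fin m × Fin m) k) :=
  Subgroup.closure
    {γ | ∃ h : GL (Fin m) k,
      (γ : Matrix (Fin m × Fin m) (Fin m × Fin m) k) = (1 : Matrix (Fin m) (Fin m) k) ⊗ₖ (h : Matrix (Fin m) (Fin m) k)}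

/-- **The realised symmetry group of `det_m`**, `𝔾_{det_m} ≃ [(GL(E) × GL(F))/k*] ⋊ ℤ₂`
(p0003:L56–L59, `ℤ₂` = transposition; equality with the projective stabiliser of `det_m` is Frobenius'
theorem, in tree `Literature.NumberTheory.DiophantineGeometry.frobenius_detPreserver_unimodular_sandwich_holds`):
generated by `leftLinearSubst`, `rightLinearSubst` and the transposition substitution `transposeSubstSet`.
This is the group of "equivariant" in Thm. 2.13 and Prop. 2.17 (p0006:L120, p0007:L82).
[cite: LandsbergRessayre2017, §1 (𝔾_{det_n})] -/
def detSymmetrySubst : Subgroup (GL (Fin m × Fin m) k) :=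
  Subgroup.closure
    ((leftLinearSubst k m : Set (GL (Fin m × Fin m) k)) ∪ rightLinearSubst k m ∪ transposeSubstSet k m)

/-- `N(T^{GL(E)}) ≤ GL(E)` (p0005:L113–L114): the left monomial symmetries are left linear symmetries.
[cite: LandsbergRessayre2017, §2.2] -/
theorem leftMonomialSubst_le_leftLinearSubst : leftMonomialSubst k m ≤ leftLinearSubst k m := by
  refine Subgroup.closure_mono ?_
  rintro γ ⟨g, -, hg⟩
  exact ⟨g, hg⟩

/-- `GL(E) ≤ 𝔾_{det_m}` (p0003:L56–L59). [cite: LandsbergRessayre2017, §1 (𝔾_{det_n})] -/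
theorem leftLinearSubst_le_detSymmetrySubst : leftLinearSubst k m ≤ detSymmetrySubst k m :=
  fun _ hγ => Subgroup.subset_closure (Or.inl (Or.inl hγ))

/-- `GL(F) ≤ 𝔾_{det_m}` (p0003:L56–L59). [cite: LandsbergRessayre2017, §1 (𝔾_{det_n})] -/
theorem rightLinearSubst_le_detSymmetrySubst : rightLinearSubst k m ≤ detSymmetrySubst k m :=
  fun _ hγ => Subgroup.subset_closure (Or.inl (Or.inr hγ))

end MatrixSymmetries

/-! ## Def. 2.12 (p0006:L112–L120): `rdc` and the regular equivariant complexity -/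

section Regular

variable {k : Type*} [Field k] {σ : Type*}

/-- `f` has a REGULAR affine determinantal representation of size `n` (`IsRegularDetRepr`: affine
entries, `det A = f`, `rank A(0) = n - 1`; LR17 Def. 2.12, p0006:L114–L116).
[cite: LandsbergRessayre2017, Def. 2.12] -/
def HasRegularDetRepr (f : MvPolynomial σ k) (n : ℕ) : Prop :=
  ∃ A : Matrix (Fin n) (Fin n) (MvPolynomial σ k), IsRegularDetRepr f A

/-- The **regular determinantal complexity** `rdc(P)`: the minimal size of a regular determinantal
representation (LR17 Def. 2.12, p0006:L118–L120; also Question 2.18, p0007:L106–L108). An `sInf` over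
`ℕ`, junk value `0` if `f` has no regular representation of any size. [cite: LandsbergRessayre2017, Def. 2.12] -/
def regularDetComplexity (f : MvPolynomial σ k) : ℕ :=
  sInf {n : ℕ | HasRegularDetRepr f n}

variable [Fintype σ] [DecidableEq σ]

/-- `f` has a regular AND `Γ`-equivariant affine determinantal representation of size `n` (LR17
Def. 2.12, "regular equivariant determinantal representation", p0006:L120; equivariance in the tree's
exact-lift sense `IsEquivariantDetRepr`). [cite: LandsbergRessayre2017, Def. 2.12] -/
def HasRegularEquivariantDetRepr (Γ : Subgroup (GL σ k)) (f : MvPolynomial σ k) (n : ℕ) : Prop :=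
  ∃ A : Matrix (Fin n) (Fin n) (MvPolynomial σ k), IsRegularDetRepr f A ∧ IsEquivariantDetRepr Γ f A

/-- LR's `\srdc(P)` for the symmetry group `Γ`: the minimal size of a regular `Γ`-equivariant determinantal
representation (LR17 Def. 2.12, p0006:L120, with `Γ = 𝔾_P` there). `sInf` over `ℕ`, junk `0` if none
exists. [cite: LandsbergRessayre2017, Def. 2.12] -/
def regularEquivariantDetComplexity (Γ : Subgroup (GL σ k)) (f : MvPolynomial σ k) : ℕ :=
  sInf {n : ℕ | HasRegularEquivariantDetRepr Γ f n}

omit [Fintype σ] [DecidableEq σ] in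
/-- A regular representation is a representation: `HasRegularDetRepr f n → HasDetRepr f n`.
[cite: LandsbergRessayre2017, Def. 2.12] -/
theorem HasRegularDetRepr.hasDetRepr {f : MvPolynomial σ k} {n : ℕ} (h : HasRegularDetRepr f n) :
    HasDetRepr f n :=
  h.imp fun _ hA => hA.isAffineDetRepr

omit [Fintype σ] [DecidableEq σ] in
/-- `rdc(f) ≤ n` as soon as a regular representation of size `n` exists. [cite: LandsbergRessayre2017, Def. 2.12] -/
theorem regularDetComplexity_le {f : MvPolynomial σ k} {n : ℕ} (h : HasRegularDetRepr f n) :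
    regularDetComplexity f ≤ n :=
  Nat.sInf_le h

omit [Fintype σ] [DecidableEq σ] in
/-- `dc(f) ≤ rdc(f)` whenever some regular representation exists (otherwise `rdc` is the junk `0`)
(IL17 §2 "by definition `dc(P) ≤ rdc(P)`"). [cite: LandsbergRessayre2017, Def. 2.12] -/
theorem determinantalComplexity_le_regularDetComplexity {f : MvPolynomial σ k}
    (h : ∃ n, HasRegularDetRepr f n) : determinantalComplexity f ≤ regularDetComplexity f := by
  have hmem : HasRegularDetRepr f (regularDetComplexity f) := Nat.sInf_mem h
  exact Nat.sInf_le hmem.hasDetRepr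

/-- A regular equivariant representation is an equivariant one. [cite: LandsbergRessayre2017, Def. 2.12] -/
theorem HasRegularEquivariantDetRepr.hasEquivariantDetRepr {Γ : Subgroup (GL σ k)}
    {f : MvPolynomial σ k} {n : ℕ} (h : HasRegularEquivariantDetRepr Γ f n) :
    HasEquivariantDetRepr Γ f n :=
  h.imp fun _ hA => hA.2

/-- `\srdc_Γ(f) ≤ n` from a witness. [cite: LandsbergRessayre2017, Def. 2.12] -/
theorem regularEquivariantDetComplexity_le {Γ : Subgroup (GL σ k)} {f : MvPolynomial σ k} {n : ℕ}
    (h : HasRegularEquivariantDetRepr Γ f n) : regularEquivariantDetComplexity Γ f ≤ n :=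
  Nat.sInf_le h

end Regular

/-! ## §2.3 (p0006:L49–L82): Prop. 2.10, the equivariant representation of `perm_m` of size `C(2m,m) - 1` -/

namespace LR17

variable (k : Type*) [CommRing k] (m : ℕ)

/-- Index of the basis of `⊕_{j=0}^{m-1} Λ^j E` (equivalently `⊕_{j<m} (S^jE)_reg`, p0006:L32,
p0007:L25): the proper subsets `S ⊊ [m]` (`e_S = ∧_{s ∈ S} e_s`, resp. `∏_{s∈S} e_s`), the level being
`|S|`; cardinality `2^m - 1`. [cite: LandsbergRessayre2017, Prop. 2.16] -/
abbrev HalfIdx : Type := {S : Finset (Fin m) // S ≠ Finset.univ}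

/-- Index of the basis of `⊕_{j=0}^{m-1} Λ^jE ⊗ Λ^jF*` (equivalently `⊕_{j<m} (S^jE)_reg ⊗ (S^jF*)_reg`,
p0006:L68, p0007:L83): pairs `(S, R)` of subsets of `[m]` with `|S| = |R| < m`; cardinality
`Σ_{j<m} C(m,j)² = C(2m,m) - 1`. [cite: LandsbergRessayre2017, Prop. 2.17] -/
abbrev FullIdx : Type := {p : Finset (Fin m) × Finset (Fin m) // p.1.card = p.2.card ∧ p.1 ≠ Finset.univ}

/-- The fixed identifications `Λ^m E ≃ Λ^0 E`, `S^0E ≃ (S^mE)_reg` (p0006:L33, L69, p0007:L27, L85):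
the full set `[m]` (top level) is represented by `∅` (level `0`). [cite: LandsbergRessayre2017, Prop. 2.16] -/
def wrap (T : Finset (Fin m)) : Finset (Fin m) := if T = Finset.univ then ∅ else T

/-- The printed scalar `(m!)^{-1/(n-m)}` on `Λ₀` in Props. 2.10 and 2.17 (p0006:L77, p0007:L91), with
`n = C(2m,m) - 1`; a real number (for `m = 1`, where `n = m` and `Λ₀ = 0`, Lean's `x / 0 = 0` makes it
`1`). [cite: LandsbergRessayre2017, Prop. 2.10] -/
def lamScale : ℝ :=
  (m.factorial : ℝ) ^ (-(1 : ℝ) / (((2 * m).choose m - 1 - m : ℕ) : ℝ))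

/-- **Prop. 2.10's matrix** `Ã = c Λ₀ + Σ_{k=0}^{m-1} S_k` on `ℂ^n = ⊕_{k<m} (S^kE)_reg ⊗ (S^kF*)_reg`
(p0006:L66–L82), in the basis `e_S ⊗ f_R` indexed by `FullIdx m`, with the scalar `c` on `Λ₀` as a
parameter: the entry in row `(T, U)` and column `(S, R)` is `c` if `(T,U) = (S,R)` has level `≥ 1`
(`Λ₀ = Σ_{k ≥ 1} Id`, p0006:L72–L74), plus `x_{ij}` if `T = S ∪ {i}`, `U = R ∪ {j}` with `i ∉ S`,
`j ∉ R` (`S_k(e_i ⊗ f_j)` = multiplication by `e_i` and `f_j` followed by projection to the square-free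
part, p0006:L53–L56; the top level wrapped to level `0`). The variable `x_{ij} = X (i, j)` is the entry in
row `i` (the `E`-index) and column `j` (the `F*`-index) of the generic matrix, as in `perPoly`.
[cite: LandsbergRessayre2017, Prop. 2.10] -/
def permFullMatrix (c : k) : Matrix (FullIdx m) (FullIdx m) (MvPolynomial (Fin m × Fin m) k) :=
  Matrix.of fun T S =>
    (if T = S ∧ S.1.1.Nonempty then C c else 0) +
      ∑ i : Fin m, ∑ j : Fin m,
        if i ∉ S.1.1 ∧ j ∉ S.1.2 ∧ T.1.1 = wrap m (insert i S.1.1) ∧ T.1.2 = wrap m (insert j S.1.2)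
        then X (i, j) else 0

end LR17

/-- NAMED FACT (**LR17 Prop. 2.10**, p0006:L66–L82; proof p0014:L3–L15 with p0013:L41–L109): for every
`m ≥ 1`, the matrix `LR17.permFullMatrix m c` with the printed scalar `c = (m!)^{-1/(n-m)}`,
`n = C(2m,m) - 1`, transported to `Fin n` along ANY bijection, is an affine determinantal representation of
`(-1)^{m+1} perm_m` ("Then `(-1)^{m+1} perm_m = det_n ∘ Ã`", p0006:L79) which is EQUIVARIANT — for the
full realised symmetry group `permSymmetrySubst ℂ m` = LR's `𝔾_{perm_m}` (p0005:L118–L121), in the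
tree's exact-lift sense, which is what the printed proof gives (torus and permutations act through the
monomial bases, the transposition through the swap `(S,R) ↦ (R,S)`, p0013:L89–L109 "there exist two
permutation matrices `B₁, B₂` … `Ã(Mᵀ) = B₁ Ã(M) B₂⁻¹`", transferred to the permanent at p0014:L14).
Together with `lr_full_equivariant_lower_holds` this is Thm. 2.1, `edc(perm_m) = C(2m,m) - 1` for `m ≥ 3`
(companion Proofs file: `lr_thm_2_1_le`, `lr_thm_2_1_eq`). Users take `(h : lr_prop_2_10)`.
[cite: LandsbergRessayre2017, Prop. 2.10] -/
def lr_prop_2_10 : Prop :=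
  ∀ m : ℕ, 1 ≤ m → ∀ (n : ℕ) (e : LR17.FullIdx m ≃ Fin n),
    IsEquivariantDetRepr (permSymmetrySubst ℂ m) (C ((-1 : ℂ) ^ (m + 1)) * perPoly (Fin m) ℂ)
      (Matrix.reindex e e (LR17.permFullMatrix ℂ m (LR17.lamScale m : ℂ)))

/-! ## §2.4 (p0006:L84–L105) and Example 1.4 (p0004:L1–L62): quadrics, Prop. 2.11 -/

section Quadrics

variable {k : Type*} [CommRing k] {σ : Type*} [Fintype σ] [DecidableEq σ]

/-- A **nondegenerate quadratic form** `Q ∈ S²k^{σ*}` ("a homogeneous polynomial of degree 2",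
nondegenerate, p0006:L100–L101; Example 1.4 `Q = Σ z_j²`, §2.4 `Q = Σ x_j y_j`): `Q = Σ_{i,j} S_{ij} x_i x_j`
for a symmetric matrix `S` with invertible determinant. [cite: LandsbergRessayre2017, Prop. 2.11] -/
def IsNondegQuadraticForm (Q : MvPolynomial σ k) : Prop :=
  ∃ S : Matrix σ σ k, S.IsSymm ∧ IsUnit S.det ∧ Q = ∑ i, ∑ j, C (S i j) * (X i * X j)

/-- **Example 1.4's matrix** (p0004:L5, L27–L31) `Ã = [[0, -Xᵀ], [X, Id_M]]` of size `M + 1` for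
`Q = Σ_j z_j²`, indexed by `Option (Fin M)` (`none` = the first row/column): `det Ã = Q`, and `Ã` respects
`𝔾_Q = k* × O(M)` with the exact lifts `Z ↦ diag(λ, B) Z diag(λ⁻¹, B)⁻¹` (p0004:L6–L62). Recorded as
the witness behind `lr_prop_2_11_le`; nothing is asserted about it here.
[cite: LandsbergRessayre2017, Example 1.4] -/
def LR17.quadricMatrix (M : ℕ) : Matrix (Option (Fin M)) (Option (Fin M)) (MvPolynomial (Fin M) k) :=
  Matrix.of fun a b =>
    match a, b with
    | none, none => 0
    | none, some j => -X j
    | some i, none => X i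
    | some i, some j => if i = j then 1 else 0

end Quadrics

/-- NAMED FACT (**LR17 Prop. 2.11, upper bound `edc(Q) ≤ M + 1`**, p0006:L99–L105 with p0006:L96–L97
"Example 1.4 shows there is a size `2s+1` determinantal representation respecting `𝔾_Q`" and Example 1.4,
p0004:L1–L62): every nondegenerate quadratic form `Q` in `M ≥ 1` variables over `ℂ` has a
`𝔾_Q`-equivariant (`projLinStabilizer Q`; exact lifts, as printed at p0004:L6–L53) affine determinantal
representation of size `M + 1` (for `Q = Σ z_j²` the matrix `LR17.quadricMatrix M`; in general after a
linear change of coordinates, all nondegenerate quadratic forms over `ℂ` being equivalent). Users take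
`(h : lr_prop_2_11_le)`. [cite: LandsbergRessayre2017, Prop. 2.11] -/
def lr_prop_2_11_le : Prop :=
  ∀ M : ℕ, 1 ≤ M → ∀ Q : MvPolynomial (Fin M) ℂ, IsNondegQuadraticForm Q →
    HasEquivariantDetRepr (projLinStabilizer Q) Q (M + 1)

/-- NAMED FACT (**LR17 Prop. 2.11, lower bound `edc(Q) ≥ M + 1`**, p0006:L99–L105; proof p0011:L26–L76)
— WITH AN ERRATUM ON THE RANGE. As printed: "Let `Q ∈ S²ℂ^{M*}` be a nondegenerate quadratic form …
Then `edc(Q) = M + 1`", no restriction on `M`. Corrected here to `M ≥ 5`. Reason: the printed proof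
begins "By Lemma 3.2, one may assume that `Ã(0) = Λ_{n-1}`" (p0011:L29–L30), and Lemma 3.2 (von zur
Gathen, p0009:L56–L58) requires `codim {Q = 0}_sing ≥ 5`, i.e. `M ≥ 5` for a nondegenerate quadric
(`{Q=0}_sing = {0}`); for small `M` the statement is FALSE as printed, in LR's own sense and in the
tree's: `Q = xy` (`M = 2`) has the `𝔾_Q`-equivariant representation `diag(x, y)` of size `2 < 3`
(`𝔾_Q` = monomial `2 × 2` matrices, lifted by `(diag(a,b), 1)` and the swap), and for `M = 4`,
`Q = det₂` has `edc(det₂) = 2 < 5` by the authors' own remark "this representation is equivariant so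
`edc(det_m) = m`" (p0006:L124–L125). With regularity automatic (`M ≥ 5`) the printed argument
(p0011:L32–L76: a Levi factor of `ρ̄_A⁻¹(𝔾_Q)` maps onto `𝔾_Q°`, `A(V) ≅ V` is irreducible, its
projection to `ℓ₁* ⊗ ℍ` is non-zero, so `dim ℍ ≥ dim V = M`) gives `n ≥ M + 1` for every
`𝔾_Q`-equivariant representation (the tree's exact-lift equivariance implies LR's, so the bound transfers).
Users take `(h : lr_prop_2_11_ge)`. [cite: LandsbergRessayre2017, Prop. 2.11] -/
def lr_prop_2_11_ge : Prop :=
  ∀ M : ℕ, 5 ≤ M → ∀ Q : MvPolynomial (Fin M) ℂ, IsNondegQuadraticForm Q →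
    ∀ (n : ℕ) (A : Matrix (Fin n) (Fin n) (MvPolynomial (Fin M) ℂ)),
      IsEquivariantDetRepr (projLinStabilizer Q) Q A → M + 1 ≤ n

/-- **LR17 Prop. 2.11** as printed (`edc(Q) = M + 1`, p0006:L103–L104), in the corrected range `M ≥ 5`,
from its two halves `lr_prop_2_11_le`, `lr_prop_2_11_ge` (the tree's `equivariantDetComplexity` is an
attained `sInf`). [cite: LandsbergRessayre2017, Prop. 2.11] -/
theorem lr_prop_2_11_eq (hle : lr_prop_2_11_le) (hge : lr_prop_2_11_ge) {M : ℕ} (hM : 5 ≤ M)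
    {Q : MvPolynomial (Fin M) ℂ} (hQ : IsNondegQuadraticForm Q) :
    equivariantDetComplexity (projLinStabilizer Q) Q = M + 1 := by
  refine le_antisymm (equivariantDetComplexity_le (hle M (by omega) Q hQ)) ?_
  have hmem : HasEquivariantDetRepr (projLinStabilizer Q) Q
      (equivariantDetComplexity (projLinStabilizer Q) Q) :=
    Nat.sInf_mem (s := {n : ℕ | HasEquivariantDetRepr (projLinStabilizer Q) Q n}) ⟨M + 1, hle M (by omega) Q hQ⟩
  obtain ⟨A, hA⟩ := hmem
  exact hge M hM Q hQ _ A hA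

/-! ## §2.5 (p0006:L107–L142, p0007:L1–L125): regular representations of `det_m` — Thms. 2.13, 2.14,
Props. 2.16, 2.17, Question 2.18 -/

namespace LR17

variable (k : Type*) [CommRing k] (m : ℕ)

/-- **Prop. 2.16's matrix** `Ã = Λ₀ + Σ_{k=0}^{m-1} ex_k f_{k+1}` on `ℂ^n = ⊕_{j<m} Λ^jE`, `n = 2^m - 1`
(p0007:L22–L40), in the basis `e_S` (`S ⊊ [m]`, increasing wedge), row `T`, column `S`: `1` on the diagonal
at levels `≥ 1` (`Λ₀ = Σ_{k≥1} Id_{Λ^kE}`, p0007:L30), plus, when `T = S ∪ {i}` with `i ∉ S` (top level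
wrapped to `∅`), the Koszul sign `ε(S,i) = (-1)^{#{s ∈ S | s < i}}` of `e_i ∧ e_S = ε(S,i) e_{S∪{i}}`
(`ex_k(v)(ω) = v ∧ ω`, p0007:L18–L19; "Note the minus sign in front of `y²₂` because
`ex(e₂)(e₁) = -e₁∧e₂`", p0007:L55–L56) times the variable `y^{k+1}_i = X (i, |S|)` — column `k+1` of the
matrix of variables feeds the block `Λ^kE → Λ^{k+1}E` (`f_{k+1}`, p0007:L34; the tree's `Grenet.wt`).
The printed `m = 2, 3` instances are p0007:L47–L53 and p0007:L61–L70. [cite: LandsbergRessayre2017, Prop. 2.16] -/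
def detHalfMatrix : Matrix (HalfIdx m) (HalfIdx m) (MvPolynomial (Fin m × Fin m) k) :=
  Matrix.of fun T S =>
    (if T = S ∧ S.1.Nonempty then 1 else 0) +
      ∑ i : Fin m, if i ∉ S.1 ∧ T.1 = wrap m (insert i S.1)
        then C (koszulSign S.1 i : k) * Grenet.wt k m i S.1.card else 0

/-- The printed sign of Prop. 2.16 (p0007:L35–L36): "`det_m = det_n ∘ Ã` if `m ≡ 1, 2 mod 4` and
`det_m = -det_n ∘ Ã` if `m ≡ 0, 3 mod 4`", i.e. `det Ã = detHalfSign m · det_m` with this `±1`.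
[cite: LandsbergRessayre2017, Prop. 2.16] -/
def detHalfSign : ℤ := if m % 4 = 1 ∨ m % 4 = 2 then 1 else -1

/-- **Prop. 2.17's matrix** `Ã = c Λ₀ + Σ_{k=0}^{m-1} EX_k` on `ℂ^n = ⊕_{j<m} Λ^jE ⊗ Λ^jF*`,
`n = C(2m,m) - 1` (p0007:L73–L93), basis `e_S ⊗ f_R` indexed by `FullIdx m`, scalar `c` on `Λ₀` as a
parameter: entry (row `(T,U)`, column `(S,R)`) = `c` on the diagonal at levels `≥ 1`, plus
`ε(S,i) ε(R,j) x_{ij}` when `T = S ∪ {i}`, `U = R ∪ {j}`, `i ∉ S`, `j ∉ R`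
(`EX_k(e ⊗ f)(ω ⊗ η) = (e ∧ ω) ⊗ (f ∧ η)`, p0007:L77–L78; top level wrapped to `(∅, ∅)`).
[cite: LandsbergRessayre2017, Prop. 2.17] -/
def detFullMatrix (c : k) : Matrix (FullIdx m) (FullIdx m) (MvPolynomial (Fin m × Fin m) k) :=
  Matrix.of fun T S =>
    (if T = S ∧ S.1.1.Nonempty then C c else 0) +
      ∑ i : Fin m, ∑ j : Fin m,
        if i ∉ S.1.1 ∧ j ∉ S.1.2 ∧ T.1.1 = wrap m (insert i S.1.1) ∧ T.1.2 = wrap m (insert j S.1.2)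
        then C ((koszulSign S.1.1 i * koszulSign S.1.2 j : ℤ) : k) * X (i, j) else 0

end LR17

/-- NAMED FACT (**LR17 Thm. 2.13, lower bound**, p0006:L127–L129: "`\srdc(det_m) = C(2m,m) - 1`";
the proof is "very similar to" that of the half-symmetric case and of Thm. 2.1 and is omitted in print,
p0015:L115–L116 — the tree PROVES the permanent analogue `lr_full_equivariant_lower_holds`): every
REGULAR affine determinantal representation of `det_m` over `ℂ` which is equivariant (exact lifts) for the
full realised symmetry group `detSymmetrySubst ℂ m` = `𝔾_{det_m}` has size `≥ C(2m,m) - 1`. No lower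
bound on `m` is printed; for `m ≤ 1` the inequality is trivial. LR's equivariance (lifts in
`𝔾_{det_n} ⊇ GL_n × GL_n`) is implied by the tree's, so the bound transfers verbatim. The matching
construction is `lr_prop_2_17`. Users take `(h : lr_thm_2_13_ge)`. [cite: LandsbergRessayre2017, Thm. 2.13] -/
def lr_thm_2_13_ge : Prop :=
  ∀ (m n : ℕ) (A : Matrix (Fin n) (Fin n) (MvPolynomial (Fin m × Fin m) ℂ)),
    IsRegularDetRepr (detPoly (Fin m) ℂ) A →
      IsEquivariantDetRepr (detSymmetrySubst ℂ m) (detPoly (Fin m) ℂ) A → (2 * m).choose m - 1 ≤ n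

/-- NAMED FACT (**LR17 Thm. 2.14, lower bound**, p0006:L135–L139; proof p0012:L90–p0013:L39): "Let `Ã_m`
be a regular determinantal representation of `det_m` that respects `GL(E)`. Then `n ≥ 2^m - 1`." — every
regular affine determinantal representation of `det_m` over `ℂ` equivariant (exact lifts) for left
multiplication `leftLinearSubst ℂ m` has size `≥ 2^m - 1` (no lower bound on `m` printed; `m = 2` is
treated separately in the proof, p0012:L126–L129; `m ≤ 1` trivial). Users take `(h : lr_thm_2_14_ge)`.
[cite: LandsbergRessayre2017, Thm. 2.14] -/
def lr_thm_2_14_ge : Prop :=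
  ∀ (m n : ℕ) (A : Matrix (Fin n) (Fin n) (MvPolynomial (Fin m × Fin m) ℂ)),
    IsRegularDetRepr (detPoly (Fin m) ℂ) A →
      IsEquivariantDetRepr (leftLinearSubst ℂ m) (detPoly (Fin m) ℂ) A → 2 ^ m - 1 ≤ n

/-- NAMED FACT (**LR17 Prop. 2.16**, p0007:L22–L40; proof p0012:L38–L88): for `m ≥ 1`, the matrix
`LR17.detHalfMatrix m` (size `2^m - 1`), transported to `Fin n` along any bijection, is a REGULAR affine
determinantal representation of `detHalfSign m · det_m` ("`det_m = det_n∘Ã` if `m ≡ 1,2 mod 4` and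
`det_m = -det_n∘Ã` if `m ≡ 0,3 mod 4`", p0007:L35–L36) that RESPECTS `GL(E)` (`leftLinearSubst ℂ m`;
exact lifts `Ã(g·u) = (⊕_i ∧^i g) Ã(u) (⊕_j ∧^j g)⁻¹`, p0012:L40–L63). This is the "Moreover" half of
Thm. 2.14 (companion Proofs file: `lr_thm_2_14_le`). Users take `(h : lr_prop_2_16)`.
[cite: LandsbergRessayre2017, Prop. 2.16] -/
def lr_prop_2_16 : Prop :=
  ∀ m : ℕ, 1 ≤ m → ∀ (n : ℕ) (e : LR17.HalfIdx m ≃ Fin n),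
    IsRegularDetRepr (C ((LR17.detHalfSign m : ℤ) : ℂ) * detPoly (Fin m) ℂ)
        (Matrix.reindex e e (LR17.detHalfMatrix ℂ m)) ∧
      IsEquivariantDetRepr (leftLinearSubst ℂ m) (C ((LR17.detHalfSign m : ℤ) : ℂ) * detPoly (Fin m) ℂ)
        (Matrix.reindex e e (LR17.detHalfMatrix ℂ m))

/-- NAMED FACT (**LR17 Prop. 2.17**, p0007:L81–L93; proof p0013:L41–L109): for `m ≥ 1`, the matrix
`LR17.detFullMatrix m c` with `c = (m!)^{-1/(n-m)}`, `n = C(2m,m) - 1`, transported to `Fin n` along any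
bijection, is a REGULAR affine determinantal representation of `(-1)^{m+1} det_m` ("Then
`(-1)^{m+1} det_m = det_n ∘ Ã`", p0007:L93) which is EQUIVARIANT for the full realised symmetry group
`detSymmetrySubst ℂ m` of `det_m` (exact lifts: `GL(E) × GL(F)` through `∧^j`, p0013:L62–L71, and the
transposition through "two permutation matrices `B₁, B₂ ∈ GL_n(ℂ)` such that `Ã(Mᵀ) = B₁ Ã(M) B₂⁻¹`",
p0013:L101–L109). This is the upper half of Thm. 2.13 (companion Proofs file: `lr_thm_2_13_le`). Users take
`(h : lr_prop_2_17)`. [cite: LandsbergRessayre2017, Prop. 2.17] -/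
def lr_prop_2_17 : Prop :=
  ∀ m : ℕ, 1 ≤ m → ∀ (n : ℕ) (e : LR17.FullIdx m ≃ Fin n),
    IsRegularDetRepr (C ((-1 : ℂ) ^ (m + 1)) * detPoly (Fin m) ℂ)
        (Matrix.reindex e e (LR17.detFullMatrix ℂ m (LR17.lamScale m : ℂ))) ∧
      IsEquivariantDetRepr (detSymmetrySubst ℂ m) (C ((-1 : ℂ) ^ (m + 1)) * detPoly (Fin m) ℂ)
        (Matrix.reindex e e (LR17.detFullMatrix ℂ m (LR17.lamScale m : ℂ)))

/-- NAMED FACT (**Ikenmeyer–Landsberg 2017, Prop. 2.3**, arXiv:1610.00159 p0004:L66: "`rdc(det_m) ≤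
(1/3)(m³ - m) + 1`", answering LR17 Question 2.18, p0004:L63–L64; proof §3 via Prop. 3.1 "if the constant
term of `P` is zero then `rdc(P) ≤ labpc(P) - 1`" and Prop. 3.2, the Mahajan–Vinay layered ABP of size
`m³/3 - m/3 + 2`, p0006:L3–L37): over `ℂ`, `det_m` has a regular affine determinantal representation of
some size `n ≤ (m³ - m)/3 + 1` (size-`n` determinantal expressions of IL17 §1 = `IsAffineDetRepr`,
"regular" = `rank Λ = n - 1` = `IsRegularDetRepr`, p0004:L41–L43). `3 ∣ m³ - m`, so the `ℕ`-division is
exact. Users take `(h : ikenmeyerLandsberg2017_prop_2_3)`. [cite: IkenmeyerLandsberg2017, Prop. 2.3] -/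
def ikenmeyerLandsberg2017_prop_2_3 : Prop :=
  ∀ m : ℕ, ∃ n : ℕ, n ≤ (m ^ 3 - m) / 3 + 1 ∧ HasRegularDetRepr (detPoly (Fin m) ℂ) n

end Literature.Computability.AlgebraicComplexity

end
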